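import Summits.KontsevichZagierPeriods.KontsevichZagierPeriods.Theses.HurwitzMicroSectors
import Summits.KontsevichZagierPeriods.KontsevichZagierPeriods.Theorems.HurwitzMicroSectorsNormalFormPrinciplePiBoxTransfer
import Summits.KontsevichZagierPeriods.KontsevichZagierPeriods.Theorems.HurwitzMicroSectorsNormalFormPrincipleVariants2320

/-! TTRL-lite variant V2278 of stmt-KontsevichZagierPeriods-3869

Variant V2278 = `stub_boxRigidity` (the leaf `BoxRigidity` of `NormalFormPrinciple`: two BOX-RATIONAL
representations — domain the open unit box, integrand `p/q` with `p, q` over `ℚ`, `q ≠ 0` on the box —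
with equal values are KZ-equivalent) under the move `fix_nat:m=4; bound_nat:m'≤6` (left dimension
frozen to `4`, right dimension `m' ≤ 6`). Verdict of the attempt seat: **open** — this file is the
exact-strength certificate, not a proof of the variant. The bound EXCEEDS the frozen dimension, so the
strength is set by the right-hand side: by the tree's general fact
`boxRigidityFixBound_iff_boxVanishing_snd` (file `…Variants2320`, case `K = 4 ≤ b = 6`) the variant is
EXACTLY BoxVanishing in dimension `6` — every box-rational representation on `(0,1)⁶` of value `0` is a
KZ relation (`stub_boxRigidity_var2278_iff_boxVanishing_six`): forward by comparing the zero
representation on `(0,1)⁴` (box-rational, value `0`, itself a relation) with a vanishing representation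
on `(0,1)⁶` (the pair `(4, 6)` is allowed), backward by padding both representations to `(0,1)⁶` by unit
intervals (one Newton–Leibniz move each) and subtracting there (rule 1b; `boxRigidityLe_of_boxVanishing`,
file `…Variants2239`). Equivalently: BoxRigidity under the joint bound `m, m' ≤ 6`
(`stub_boxRigidity_var2278_iff_le_six` — verbatim the right-hand side of the sibling certificates
`stub_boxRigidity_var2295_iff_le_six`, `…var2302…`, `…var2304…`, so V2278 coincides with every two-sided
sibling of maximal dimension `6`), and the same statement as the mirror move `bound_nat:m≤6; fix_nat:m'=4`
(`stub_boxRigidity_var2278_iff_mirror`, `Equivalent` is symmetric). It implies BoxVanishing in every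
dimension `≤ 6` (`boxVanishing_le_six_of_stub_boxRigidity_var2278`) and the sibling V2275
(`m = 4, m' ≤ 5`, = BoxVanishing `5`; `stub_boxRigidity_var2275_of_var2278`). BoxVanishing `6` is
Conjecture 1 of Kontsevich–Zagier in kernel form for all rational integrands over `ℚ` on the boxes
`(0,1)^{≤ 6}` (`ζ(3)²` versus `π⁶`, `ζ(5)`, `ζ(3)`, `π⁴`, `β(4)`, `Li_k` at rationals, Catalan's `G` versus
`π²`, …): deciding it presupposes the open transcendence questions it quantifies over, and no uniform
chain of moves is known from dimension `2` on; the tree proves only dimension `≤ 1`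
(`boxRigidity_of_le_one`, Baker). Conversely `KontsevichZagierPeriods ⇒ parent ⇒ V2278`
(`stub_boxRigidity_var2278_of_statement`), so a refutation of the variant would refute the Summit, and no
invariant of `KZ.relations` finer than `eval` is known (soundness `relations_le_ker_eval_holds` is the
only one in the tree).
Source: M. Kontsevich, D. Zagier, *Periods* (2001), §1.2 Conjecture 1. Pure proof file, no definitions. -/

-- `Summit.<Summit>.<Problem>` is the tree's mandated summit-side namespace (CONVENTIONS §2); for this
-- single-conjunct summit the two coincide, so the duplicate is deliberate.
set_option linter.dupNamespace false

noncomputable section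

namespace Summit.KontsevichZagierPeriods.KontsevichZagierPeriods.Theorems

open MeasureTheory Set
open Literature.NumberTheory.Transcendental Literature.NumberTheory.Transcendental.KZ
open Summit.KontsevichZagierPeriods.KontsevichZagierPeriods.Theses.HurwitzMicroSectors
open Summit.KontsevichZagierPeriods.HurwitzMicroSectors.NormalFormPrinciple.PiBox

/-! ## The variant V2278: exactly `BoxVanishing 6` -/

/-- **V2278 ⟺ BoxVanishing in dimension `6`** (every box-rational representation on `(0,1)⁶` of
value `0` is a KZ relation): instance `K = 4 ≤ b = 6` of `boxRigidityFixBound_iff_boxVanishing_snd`.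
[cite: KontsevichZagier2001, §1.2 Conjecture 1] -/
theorem stub_boxRigidity_var2278_iff_boxVanishing_six :
    (∀ (m' : ℕ) (N : IntegralRep 4) (N' : IntegralRep m'), m' ≤ 6 → N.domain = {x | ∀ i, x i ∈ Set.Ioo (0:ℝ) 1} → N.IsRational → N'.domain = {x | ∀ i, x i ∈ Set.Ioo (0:ℝ) 1} → N'.IsRational → N.value = N'.value → Equivalent N N') ↔
    (∀ (M : IntegralRep 6), M.domain = {x | ∀ i, x i ∈ Set.Ioo (0:ℝ) 1} → M.IsRational →
      M.value = 0 → of M ∈ relations) :=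
  boxRigidityFixBound_iff_boxVanishing_snd (by norm_num)

/-- **V2278 ⟺ BoxRigidity under the joint bound `m, m' ≤ 6`** (the honest strength of the variant:
freezing `m := 4` loses nothing once `m' ≤ 6` is allowed; this right-hand side is verbatim that of the
sibling certificates of maximal dimension `6`). [cite: KontsevichZagier2001, §1.2 Conjecture 1] -/
theorem stub_boxRigidity_var2278_iff_le_six :
    (∀ (m' : ℕ) (N : IntegralRep 4) (N' : IntegralRep m'), m' ≤ 6 → N.domain = {x | ∀ i, x i ∈ Set.Ioo (0:ℝ) 1} → N.IsRational → N'.domain = {x | ∀ i, x i ∈ Set.Ioo (0:ℝ) 1} → N'.IsRational → N.value = N'.value → Equivalent N N') ↔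
    (∀ (m m' : ℕ) (N : IntegralRep m) (N' : IntegralRep m'), m ≤ 6 → m' ≤ 6 →
      N.domain = {x | ∀ i, x i ∈ Set.Ioo (0:ℝ) 1} → N.IsRational →
      N'.domain = {x | ∀ i, x i ∈ Set.Ioo (0:ℝ) 1} → N'.IsRational →
      N.value = N'.value → Equivalent N N') := by
  rw [stub_boxRigidity_var2278_iff_boxVanishing_six]
  exact ⟨fun hvan m m' N N' hm hm' => boxRigidityLe_of_boxVanishing (j := 6) (k := 6) le_rfl le_rfl
      hvan m m' N N' hm' hm,
    fun h => boxVanishing_of_boxRigidityLe (j := 6) (k := 6) le_rfl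
      fun m m' N N' hm' hm => h m m' N N' hm hm'⟩

/-- **V2278 ⟺ its mirror `bound_nat:m≤6; fix_nat:m'=4`** (the RIGHT dimension frozen to `4`, the left
bounded by `6`): `Equivalent` is symmetric, so the frozen side is immaterial.
[cite: KontsevichZagier2001, §1.2 Conjecture 1] -/
theorem stub_boxRigidity_var2278_iff_mirror :
    (∀ (m' : ℕ) (N : IntegralRep 4) (N' : IntegralRep m'), m' ≤ 6 → N.domain = {x | ∀ i, x i ∈ Set.Ioo (0:ℝ) 1} → N.IsRational → N'.domain = {x | ∀ i, x i ∈ Set.Ioo (0:ℝ) 1} → N'.IsRational → N.value = N'.value → Equivalent N N') ↔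
    (∀ (m : ℕ) (N : IntegralRep m) (N' : IntegralRep 4), m ≤ 6 →
      N.domain = {x | ∀ i, x i ∈ Set.Ioo (0:ℝ) 1} → N.IsRational →
      N'.domain = {x | ∀ i, x i ∈ Set.Ioo (0:ℝ) 1} → N'.IsRational →
      N.value = N'.value → Equivalent N N') :=
  ⟨fun h m N N' hm hNd hNr hN'd hN'r hv => (h m N' N hm hN'd hN'r hNd hNr hv.symm).symm,
    fun h m' N N' hm' hNd hNr hN'd hN'r hv => (h m' N' N hm' hN'd hN'r hNd hNr hv.symm).symm⟩

/-- **V2278 ⇒ BoxVanishing in every dimension `≤ 6`** (monotonicity along padding,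
`boxVanishing_mono`); the first open level is `2`. [cite: KontsevichZagier2001, §1.2 Conjecture 1] -/
theorem boxVanishing_le_six_of_stub_boxRigidity_var2278
    (h : ∀ (m' : ℕ) (N : IntegralRep 4) (N' : IntegralRep m'), m' ≤ 6 → N.domain = {x | ∀ i, x i ∈ Set.Ioo (0:ℝ) 1} → N.IsRational → N'.domain = {x | ∀ i, x i ∈ Set.Ioo (0:ℝ) 1} → N'.IsRational → N.value = N'.value → Equivalent N N')
    {j : ℕ} (hj : j ≤ 6) (N : IntegralRep j) (hNd : N.domain = {x | ∀ i, x i ∈ Set.Ioo (0:ℝ) 1})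
    (hNr : N.IsRational) (hv : N.value = 0) : of N ∈ relations :=
  boxVanishing_mono hj (stub_boxRigidity_var2278_iff_boxVanishing_six.1 h) N hNd hNr hv

/-- **BoxVanishing `6` ⇒ V2278** (the converse reading of the certificate, in the form a future proof of
the dimension-`6` kernel statement would be consumed). [cite: KontsevichZagier2001, §1.2 Conjecture 1] -/
theorem stub_boxRigidity_var2278_of_boxVanishing_six
    (hvan : ∀ (M : IntegralRep 6), M.domain = {x | ∀ i, x i ∈ Set.Ioo (0:ℝ) 1} → M.IsRational →
      M.value = 0 → of M ∈ relations) :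
    ∀ (m' : ℕ) (N : IntegralRep 4) (N' : IntegralRep m'), m' ≤ 6 → N.domain = {x | ∀ i, x i ∈ Set.Ioo (0:ℝ) 1} → N.IsRational → N'.domain = {x | ∀ i, x i ∈ Set.Ioo (0:ℝ) 1} → N'.IsRational → N.value = N'.value → Equivalent N N' :=
  stub_boxRigidity_var2278_iff_boxVanishing_six.2 hvan

/-- **V2278 ⇒ the sibling V2275** (`fix_nat:m=4; bound_nat:m'≤5`, = BoxVanishing `5`): restrict the
bound. [cite: KontsevichZagier2001, §1.2 Conjecture 1] -/
theorem stub_boxRigidity_var2275_of_var2278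
    (h : ∀ (m' : ℕ) (N : IntegralRep 4) (N' : IntegralRep m'), m' ≤ 6 → N.domain = {x | ∀ i, x i ∈ Set.Ioo (0:ℝ) 1} → N.IsRational → N'.domain = {x | ∀ i, x i ∈ Set.Ioo (0:ℝ) 1} → N'.IsRational → N.value = N'.value → Equivalent N N') :
    ∀ (m' : ℕ) (N : IntegralRep 4) (N' : IntegralRep m'), m' ≤ 5 → N.domain = {x | ∀ i, x i ∈ Set.Ioo (0:ℝ) 1} → N.IsRational → N'.domain = {x | ∀ i, x i ∈ Set.Ioo (0:ℝ) 1} → N'.IsRational → N.value = N'.value → Equivalent N N' :=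
  fun m' N N' hm' => h m' N N' (hm'.trans (by norm_num))

/-- **The parent leaf ⇒ V2278** (specialisation `m = 4`; the bound `m' ≤ 6` is dropped).
[cite: KontsevichZagier2001, §1.2 Conjecture 1] -/
theorem stub_boxRigidity_var2278_of_parent
    (h : ∀ (m m' : ℕ) (N : IntegralRep m) (N' : IntegralRep m'), N.domain = {x | ∀ i, x i ∈ Set.Ioo (0:ℝ) 1} → N.IsRational → N'.domain = {x | ∀ i, x i ∈ Set.Ioo (0:ℝ) 1} → N'.IsRational → N.value = N'.value → Equivalent N N') :
    ∀ (m' : ℕ) (N : IntegralRep 4) (N' : IntegralRep m'), m' ≤ 6 → N.domain = {x | ∀ i, x i ∈ Set.Ioo (0:ℝ) 1} → N.IsRational → N'.domain = {x | ∀ i, x i ∈ Set.Ioo (0:ℝ) 1} → N'.IsRational → N.value = N'.value → Equivalent N N' :=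
  fun m' N N' _ => h 4 m' N N'

/-- **`KontsevichZagierPeriods ⇒ V2278`**: the variant is a special case of Conjecture 1 for the
tree's calculus (`leaves_of_statement`) — so a refutation of the variant would refute the Summit.
[cite: KontsevichZagier2001, §1.2 Conjecture 1] -/
theorem stub_boxRigidity_var2278_of_statement (h : _root_.KontsevichZagierPeriods) :
    ∀ (m' : ℕ) (N : IntegralRep 4) (N' : IntegralRep m'), m' ≤ 6 → N.domain = {x | ∀ i, x i ∈ Set.Ioo (0:ℝ) 1} → N.IsRational → N'.domain = {x | ∀ i, x i ∈ Set.Ioo (0:ℝ) 1} → N'.IsRational → N.value = N'.value → Equivalent N N' :=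
  stub_boxRigidity_var2278_of_parent (leaves_of_statement h).1

end Summit.KontsevichZagierPeriods.KontsevichZagierPeriods.Theorems

end
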